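import Summits.QuantumFields.YangMills.Theorems.ParabolicTrajectoryContinuumLimitOnTrajectoryRegimeTrisectionCloses
import Summits.QuantumFields.YangMills.Theorems.ParabolicTrajectoryContinuumLimitOnTrajectoryRouteRepair
import HarnessLib

/-!
# Route `ParabolicTrajectory`, crux `LatticeGapOnTrajectory` (stmt-QuantumFields-10523): the regime trisection of (A) re-glued in GAP CURRENCY — a rev-8 deciding theorem that does not consume (B) as filed

Proof file of the (B)-chain line lead (seat c9). **Defect repaired.** The (A) chain (stmt-QuantumFields-10522) split (A)
into children V/I/U (`…RegimeTrisection`, p152397) and pre-certified `RegimeTrisection.yangMills_of_subs : U → I →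
LatticeGapOnTrajectory → TunedSequenceExistsPVG → YangMills` (p152904), which consumes (B) AS FILED: `closesPVG` applies
(B)'s transfer clause `∀ sch' ~ sch, ∀ T, IsYangMillsFor r sch' T → T.HasMassGap Δ` to the canonical witness of child U.
Thirteen leads of THIS chain certify that clause underivable (residual (α), `Split.SymmetrisationOnTrajectory`,
`Negative/TransferObstruction.lean`) and (B) as filed short of a volume clause (residual (β), `Negative/Residuals.lean`); with
V/I/U as typed no other glue exists (U forgets the canonicality and the continuum gap of its witness). **Repair (currency
only).** The (A) line's reduction already delivers the continuum gap of its own witness (`reductionPVG` ends in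
`hYM.hasMassGap_of_hasCSClustering hCS`); child U merely drops it. §1 `UltravioletLimitWithGapOnTrajectory` = child U
verbatim + `∃ Δ₁ > 0, T.HasMassGap Δ₁` (route-posited, NOT asserted); §2 read-backs (⇒ U; ⇐ `ContinuumLimitWithGapPVG`);
§3 closed modulo the SAME two UV statements as U (`Reduction.reductionUVGap` = `RegimeTrisection.Reduction.reductionUV`
with the gap kept in the last line; `ultravioletLimitWithGapOnTrajectory_of_inputs : ChartExists → UVPhysics345 → U_gap`);
§4 the coherent rev-8 deciding theorems, (B) entering only as the pure-lattice Sub₁ `Split.LatticeGapOnTrajectoryLat`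
(p124272; closed by three (B) lines modulo one physics stub each) or its restatement `Split.LatticeGapOnTrajectoryRV`:
`yangMills_of_trisectionGap : U_gap → ClusteringOnTrajectory → Split.LatticeGapOnTrajectoryLat → TunedSequenceExistsPVG →
YangMills`, `yangMills_of_trisectionGapRV`, `yangMills_of_trisectionGap_inputs : ChartExists → UVPhysics345 →
ClusteringOnTrajectory → Split.LatticeGapOnTrajectoryLat → TunedSequenceExistsPVG → YangMills` (cf. `yangMills_of_allInputs`,
p145719). Refs: `…RegimeTrisection(Closes)`, `…RouteRepair` §2, `…LatticeGapOnTrajectorySplitDefs`; both cruxes' NOTES.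
-/

set_option autoImplicit false

open scoped SchwartzMap
open MeasureTheory Filter Topology
open Literature.MathematicalPhysics.QuantumFieldTheory Literature.MathematicalPhysics.QuantumLattice
open Literature.MathematicalPhysics.AQFT Literature.Probability.LatticeModels
open Summit.QuantumFields.YangMills.Theses.ParabolicTrajectory
open Summit.QuantumFields.YangMills.Cruxes.ContinuumLimitOnTrajectory.TwoOrbitSynchronisation
open Summit.QuantumFields.YangMills.Cruxes.ContinuumLimitOnTrajectory.RegimeTrisection
open Summit.QuantumFields.YangMills.Cruxes.LatticeGapOnTrajectory.OrbitKantorovichFiniteSize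
open Summit.QuantumFields.YangMills.Theorems.ContinuumLegGivenGap
  (stub_uclOfCscl stub_asympCS stub_smallRotation stub_bddSlabDensity stub_rotOfPythagorean stub_rotNiven stub_rotHyper)

noncomputable section

namespace Summit.QuantumFields.YangMills.Cruxes.LatticeGapOnTrajectory.TrisectionGap

/-! ## §1 Child U in gap currency (route-posited; NOT asserted) -/

open Classical in
/-- **Child U in gap currency — `UltravioletLimitWithGapOnTrajectory`.** VERBATIM the body of
`RegimeTrisection.UltravioletLimitOnTrajectory` (child U: the hypothesis block of (A) with polynomial volume growth and
child I's infrared data FOR THIS SEQUENCE ⇒ a witness `sch'` with the same `a, β, L` and OS data `T` with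
`IsYangMillsFor r sch' T`, `T.IsNontrivial r.curvature`, `T.IsNonGaussian r.curvature`) with ONE conjunct appended to the
conclusion: `∃ Δ₁ > 0, T.HasMassGap Δ₁` — the continuum gap of the SAME witness, which the (A) line's reduction delivers
anyway (§3). Route-posited statement (the body to file as child U of the split); NOT asserted. -/
def UltravioletLimitWithGapOnTrajectory : Prop :=
  ∀ (G : Type) [Group G] [TopologicalSpace G] [IsTopologicalGroup G] [CompactSpace G]
    [MeasurableSpace G] [BorelSpace G], IsCompactSimpleLieGroup G →
    ∀ (r : LatticeRep G), ∃ M₀ : ℕ, ∀ M : ℕ, M₀ ≤ M → 2 ≤ M → ∃ θ₀ : ℝ, 0 < θ₀ ∧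
      ∀ (θ Δ : ℝ) (sch : SpeciesScheme (YMSpecies G)) (n : ℕ → ℕ), 0 < θ → θ < θ₀ → 0 < Δ →
      (∀ k, sch.a k = ((M : ℝ) ^ n k)⁻¹) → Tendsto sch.β atTop atTop →
      (∀ t : ℕ, 0 < t → ∃ c : ℝ, Tendsto (fun k => ((M : ℝ) ^ n k) ^ 8 *
        latticeConnectedCorr r.ρ (sch.β k) (sch.side k) r.curvature.F r.curvature.F (t * M ^ n k)) atTop (𝓝 c)) →
      Tendsto (fun k => ((M : ℝ) ^ n k) ^ 8 *
        latticeConnectedCorr r.ρ (sch.β k) (sch.side k) r.curvature.F r.curvature.F (M ^ n k)) atTop (𝓝 θ) →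
      HasLatticeMassGap r sch Δ →
      (∃ N : ℕ, 1 ≤ N ∧ ∀ᶠ k in atTop, (sch.a k)⁻¹ ≤ (sch.a k * (sch.L k : ℝ)) ^ N) →
      let cn : SpeciesScheme (YMSpecies G) :=
        { a := sch.a, a_pos := sch.a_pos, tendsto_a := sch.tendsto_a, β := sch.β, L := sch.L,
          tendsto_L := sch.tendsto_L,
          c := fun s k => if s = r.curvature then ((sch.a k) ^ 4)⁻¹ else 0,
          m := fun s k => wilsonTorusMean r.ρ (sch.β k) (sch.L k) s.F }
      ((∀ (p : ℕ) (f : Fin p → 𝓢(EuclideanSpace ℝ (Fin 4), ℝ)),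
          IsOffDiagonal (SchwartzMap.tensorFin p fun i => ofRealTest (f i)) →
          ∀ ε : ℝ, 0 < ε → ∀ᶠ k in atTop, ∀ L : ℕ, sch.L k ≤ L →
            |latticeSchwinger r.ρ cn (fun s => s.F) k p (fun _ => r.curvature) f -
                wilsonCentredSchwinger r.ρ (sch.β k) L (fun _ => 1) p (fun _ => r.curvature)
                  (fun i => (blockDilate M)^[n k] (f i))| ≤ ε) ∧
        (∀ t : ℕ, 0 < t → ∀ ε : ℝ, 0 < ε → ∀ᶠ k in atTop, ∀ S : ℕ, sch.L k ≤ S →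
          ((M : ℝ) ^ n k) ^ 8 *
            |latticeConnectedCorr r.ρ (sch.β k) (sch.side k) r.curvature.F r.curvature.F (t * M ^ n k) -
              latticeConnectedCorr r.ρ (sch.β k) (2 * S + 1) r.curvature.F r.curvature.F (t * M ^ n k)| ≤ ε)) →
      (∃ Δ₁ : ℝ, 0 < Δ₁ ∧ SpeciesScheme.HasCSClustering r cn Δ₁) →
        ∃ sch' : SpeciesScheme (YMSpecies G), sch'.a = sch.a ∧ sch'.β = sch.β ∧ sch'.L = sch.L ∧
          ∃ T : OSData (YMSpecies G) 4, IsYangMillsFor r sch' T ∧ T.IsNontrivial r.curvature ∧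
            T.IsNonGaussian r.curvature ∧ ∃ Δ₁ : ℝ, 0 < Δ₁ ∧ T.HasMassGap Δ₁

/-! ## §2 Read-backs against child U and against `ContinuumLimitWithGapPVG` -/

/-- Child U in gap currency implies child U as filed by the (A) chain (drop the gap conjunct). -/
theorem ultravioletLimitOnTrajectory_of_withGap :
    UltravioletLimitWithGapOnTrajectory → UltravioletLimitOnTrajectory := by
  intro h G _ _ _ _ _ _ hG r
  obtain ⟨M₀, hM₀⟩ := h G hG r
  refine ⟨M₀, fun M hM h2 => ?_⟩
  obtain ⟨θ₀, hθ₀, hall⟩ := hM₀ M hM h2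
  refine ⟨θ₀, hθ₀, ?_⟩
  intro θ Δ sch n hθ hθθ hΔ hshape hβ htower htune hgap hgrowth _cn hqfs hcs
  obtain ⟨sch', ha, hb, hL, T, hYM, hNT, hNG, -⟩ :=
    hall θ Δ sch n hθ hθθ hΔ hshape hβ htower htune hgap hgrowth hqfs hcs
  exact ⟨sch', ha, hb, hL, T, hYM, hNT, hNG⟩

/-- Child U in gap currency is WEAKER than the (A) chain's gap-currency restatement `ContinuumLimitWithGapPVG` (ignore the
two infrared hypotheses) — so everything that closes `ContinuumLimitWithGapPVG` closes it. -/
theorem ultravioletLimitWithGapOnTrajectory_of_withGapPVG :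
    ContinuumLimitWithGapPVG → UltravioletLimitWithGapOnTrajectory := by
  intro h G _ _ _ _ _ _ hG r
  have hB : ‹MeasurableSpace G› = borel G := BorelSpace.measurable_eq
  subst hB
  obtain ⟨M₀, hM₀⟩ := h G hG r
  refine ⟨M₀, fun M hM h2 => ?_⟩
  obtain ⟨θ₀, hθ₀, hall⟩ := hM₀ M hM h2
  refine ⟨θ₀, hθ₀, ?_⟩
  intro θ Δ sch n hθ hθθ hΔ hshape hβ htower htune hgap hgrowth _cn _hqfs _hcs
  exact hall θ Δ sch n hθ hθθ hΔ hshape hβ htower htune hgap hgrowth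

/-! ## §3 Child U in gap currency is closed modulo the chart and the UV engine (same inputs as child U) -/

namespace Reduction

/-- **The reduction for child U in gap currency.** `RegimeTrisection.Reduction.reductionUV` (itself the landed v3.6
wiring `TwoOrbitSynchronisation.Reduction.reductionPVG` with the infrared data read from the hypothesis block) VERBATIM,
except for the last line, which keeps the continuum gap `Δ₁` of the canonical witness delivered by
`IsYangMillsFor.hasMassGap_of_hasCSClustering` from the Cauchy–Schwarz clustering hypothesis — exactly as
`reductionPVG` does for `ContinuumLimitWithGapPVG`. -/
theorem reductionUVGap :
    TwoOrbitSync → ChartExists → Anatomy → UVPhysics345 → ARPOfRP → TranslOfUUVB →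
      OneFieldOSLegs' → UltravioletLimitWithGapOnTrajectory := by
  intro hsync hchart hanat huv harp htransl hlegs G _ _ _ _ _ _ hG r
  obtain ⟨M₀, hM₀⟩ := hchart G hG r
  refine ⟨M₀, fun M hM h2M => ?_⟩
  obtain ⟨𝒞⟩ := hM₀ M hM h2M
  /- constants, independent of the tuning -/
  set κ₀ : ℝ := (1 - 𝒞.θ') / 2 with hκ₀_def
  have h1θ : 0 < 1 - 𝒞.θ' := by linarith [𝒞.θ'_lt_one]
  have hκ₀pos : 0 < κ₀ := by rw [hκ₀_def]; positivity
  have hdom : 𝒞.θ' * (1 + κ₀) < 1 := by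
    rw [hκ₀_def]; nlinarith [𝒞.θ'_nonneg, 𝒞.θ'_lt_one, h1θ]
  obtain ⟨ε₀, K, θ₁, hε₀, hK, hθ₁0, hθ₁1, hS⟩ := hsync 𝒞.θ' κ₀ 𝒞.θ'_nonneg hκ₀pos.le hdom
  -- the sub-window γ'
  have hev : ∀ᶠ x in 𝓝[>] (0 : ℝ), (0 < x ∧ x ≤ 𝒞.γ) ∧ 𝒞.Cκ * x ^ 2 ≤ κ₀ ∧
      𝒞.C₁ * (𝒞.C₃ * x ^ 3) ≤ ε₀ ∧ 8 * 𝒞.b * x ^ 2 ≤ 1 ∧ K * 𝒞.C₁ * (𝒞.ℓ₀ * x) ≤ 1 / 2 := by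
    have hIoc : ∀ᶠ x in 𝓝[>] (0 : ℝ), 0 < x ∧ x ≤ 𝒞.γ := by
      filter_upwards [Ioo_mem_nhdsGT 𝒞.γ_pos] with x hx using ⟨hx.1, hx.2.le⟩
    have hcts : ∀ (c : ℝ) {p : ℕ}, 0 < p → Tendsto (fun x : ℝ => c * x ^ p) (𝓝[>] 0) (𝓝 0) := by
      intro c p hp
      have hc : Continuous (fun x : ℝ => c * x ^ p) := by fun_prop
      have h := (hc.tendsto (0 : ℝ)).mono_left (nhdsWithin_le_nhds (s := Set.Ioi (0 : ℝ)))
      simpa [zero_pow hp.ne'] using h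
    have h1 : ∀ᶠ x in 𝓝[>] (0 : ℝ), 𝒞.Cκ * x ^ 2 ≤ κ₀ := (hcts 𝒞.Cκ two_pos).eventually_le_const hκ₀pos
    have h2 : ∀ᶠ x in 𝓝[>] (0 : ℝ), 𝒞.C₁ * (𝒞.C₃ * x ^ 3) ≤ ε₀ :=
      ((hcts (𝒞.C₁ * 𝒞.C₃) three_pos).eventually_le_const hε₀).mono fun x hx => by
        simpa only [mul_assoc] using hx
    have h3 : ∀ᶠ x in 𝓝[>] (0 : ℝ), 8 * 𝒞.b * x ^ 2 ≤ 1 :=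
      (hcts (8 * 𝒞.b) two_pos).eventually_le_const one_pos
    have h4 : ∀ᶠ x in 𝓝[>] (0 : ℝ), K * 𝒞.C₁ * (𝒞.ℓ₀ * x) ≤ 1 / 2 :=
      ((hcts (K * 𝒞.C₁ * 𝒞.ℓ₀) one_pos).eventually_le_const (u := 1 / 2) (by norm_num)).mono fun x hx => by
        simpa only [mul_assoc, pow_one] using hx
    exact hIoc.and (h1.and (h2.and (h3.and h4)))
  obtain ⟨γ', ⟨hγ'pos, hγ'le⟩, hκle, hprod, h8b, hsmall⟩ := hev.exists
  -- the synchronisation constants at (κ, c₁, c₃) = (Cκ γ'², C₁, C₃ γ'³)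
  have hSk := hS (𝒞.Cκ * γ' ^ 2) 𝒞.C₁ (𝒞.C₃ * γ' ^ 3) (by have := 𝒞.Cκ_nonneg; positivity) hκle
    𝒞.C₁_nonneg (by have := 𝒞.C₃_nonneg; positivity) hprod
  /- the tuning data; the infrared data are HYPOTHESES of child U -/
  refine ⟨1, one_pos, ?_⟩
  intro θ Δ sch n hθ _ hΔ hshape hβ htower htune hgap hgrowth' cn hqfs hcs
  have hgrowth : PolyVolumeGrowth sch := hgrowth'
  have hvol' : QualFiniteSize r M sch n := hqfs
  obtain ⟨Δ₁, hΔ₁, hCS⟩ : ∃ Δ₁ : ℝ, 0 < Δ₁ ∧ SpeciesScheme.HasCSClustering r (canon r sch) Δ₁ := hcs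
  -- Wilson couplings (uses β_k → ∞)
  classical
  let g : ℕ → ℝ := fun k => if h : 𝒞.B₀ ≤ sch.β k then (𝒞.betaOf_surj (sch.β k) h).choose else 𝒞.g₀
  have hgk : ∀ᶠ k in atTop, g k ∈ Set.Ioc (0 : ℝ) 𝒞.g₀ ∧ 𝒞.betaOf (g k) = sch.β k := by
    filter_upwards [hβ.eventually_ge_atTop 𝒞.B₀] with k hk
    simp only [g, dif_pos hk]
    exact (𝒞.betaOf_surj (sch.β k) hk).choose_spec
  have hgβ : Tendsto (fun k => 𝒞.betaOf (g k)) atTop atTop :=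
    hβ.congr' (hgk.mono fun k hk => hk.2.symm)
  have hn : Tendsto n atTop atTop :=
    Summit.QuantumFields.YangMills.Theorems.LatticeGapOnTrajectory.Negative.tendsto_n_of_shape sch hshape
  -- infinite-volume towers (finite-size clause (b) of the hypotheses + corr_tendsto)
  have hclose : ∀ t : ℕ, 0 < t → ∀ ε : ℝ, 0 < ε → ∀ᶠ k in atTop,
      |((M : ℝ) ^ n k) ^ 8 *
          latticeConnectedCorr r.ρ (sch.β k) (sch.side k) r.curvature.F r.curvature.F (t * M ^ n k) -
        ((M : ℝ) ^ n k) ^ 8 * 𝒞.corrInf (g k) (t * M ^ n k)| ≤ ε := by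
    intro t ht ε hε
    filter_upwards [hvol'.2 t ht ε hε, hgk] with k hk hg'
    have hT := 𝒞.corr_tendsto (g k) hg'.1 (t * M ^ n k)
    rw [hg'.2] at hT
    rw [← mul_sub, abs_mul, abs_of_nonneg (by positivity)]
    refine le_of_tendsto ((tendsto_const_nhds.sub hT).abs.const_mul _) (eventually_atTop.2 ⟨sch.L k, ?_⟩)
    intro S hS'
    exact hk S hS'
  have htowerInf : ∀ t : ℕ, 0 < t → ∃ c : ℝ,
      Tendsto (fun k => ((M : ℝ) ^ n k) ^ 8 * 𝒞.corrInf (g k) (t * M ^ n k)) atTop (𝓝 c) := by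
    intro t ht
    obtain ⟨c, hc⟩ := htower t ht
    exact ⟨c, tendsto_of_forall_eventually_abs_sub_le hc fun ε hε =>
      (hclose t ht ε hε).mono fun k hk => by rwa [abs_sub_comm] at hk⟩
  have htune1 : Tendsto (fun k => ((M : ℝ) ^ n k) ^ 8 * 𝒞.corrInf (g k) (M ^ n k)) atTop (𝓝 θ) := by
    have h := hclose 1 one_pos
    simp only [one_mul] at h
    exact tendsto_of_forall_eventually_abs_sub_le htune fun ε hε =>
      (h ε hε).mono fun k hk => by rwa [abs_sub_comm] at hk
  /- anatomy (uses θ > 0) -/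
  obtain ⟨m, g_low, J, hglow, hJ, hA⟩ :=
    hanat G r M 𝒞 γ' hγ'pos hγ'le h8b θ g n hθ (hgk.mono fun k hk => hk.1) hgβ hn htune1
  /- the pin and its readout sequence -/
  obtain ⟨t, ht, c_r, hc_r, η, hη, hpin⟩ := 𝒞.pin m g_low γ' hglow hγ'pos hγ'le
  obtain ⟨ct, hct⟩ := htowerInf t ht
  have hRd : Tendsto (fun k => 𝒞.Rd m t (g k) (J k)) atTop (𝓝 ct) := by
    refine hct.congr' ?_
    filter_upwards [hA] with k hk
    rw [TwoOrbitChart.Rd, hk.1]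
  /- the terminal chart points form a Cauchy sequence -/
  set q : ℕ → ℝ × 𝒞.E := fun k => 𝒞.orb (g k) (J k) with hq_def
  have hcauchy : CauchySeq q := by
    rw [cauchySeq_iff_tendsto_dist_atTop_0, ← prod_atTop_atTop_eq]
    have hmin : Tendsto (fun p : ℕ × ℕ => min (J p.1) (J p.2)) (atTop ×ˢ atTop) atTop :=
      tendsto_atTop.2 fun b => ((tendsto_atTop.1 (hJ.comp tendsto_fst) b).and
        (tendsto_atTop.1 (hJ.comp tendsto_snd) b)).mono fun p hp => le_min hp.1 hp.2
    have hD : Tendsto (fun p : ℕ × ℕ => |𝒞.Rd m t (g p.1) (J p.1) - 𝒞.Rd m t (g p.2) (J p.2)|)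
        (atTop ×ˢ atTop) (𝓝 0) := by
      have := ((hRd.comp tendsto_fst).sub (hRd.comp tendsto_snd)).abs
      simpa using this
    have hηp : Tendsto (fun p : ℕ × ℕ => |η (min (J p.1) (J p.2))|) (atTop ×ˢ atTop) (𝓝 0) := by
      simpa using (hη.comp hmin).abs
    have hP : Tendsto (fun p : ℕ × ℕ => θ₁ ^ (min (J p.1) (J p.2) - 𝒞.j₀)) (atTop ×ˢ atTop) (𝓝 0) :=
      (tendsto_pow_atTop_nhds_zero_of_lt_one hθ₁0 hθ₁1).comp ((tendsto_sub_atTop_nat 𝒞.j₀).comp hmin)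
    have hbound : Tendsto (fun p : ℕ × ℕ =>
        (1 + K * 𝒞.C₁) * ((2 / c_r) * (|𝒞.Rd m t (g p.1) (J p.1) - 𝒞.Rd m t (g p.2) (J p.2)| +
            |η (min (J p.1) (J p.2))|) + 4 * 𝒞.ℓ₀ * γ' * K * 𝒞.ρ * θ₁ ^ (min (J p.1) (J p.2) - 𝒞.j₀)) +
          2 * K * 𝒞.ρ * θ₁ ^ (min (J p.1) (J p.2) - 𝒞.j₀)) (atTop ×ˢ atTop) (𝓝 0) := by
      have := ((((hD.add hηp).const_mul (2 / c_r)).add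
        (hP.const_mul (4 * 𝒞.ℓ₀ * γ' * K * 𝒞.ρ))).const_mul (1 + K * 𝒞.C₁)).add
        (hP.const_mul (2 * K * 𝒞.ρ))
      simpa using this
    refine squeeze_zero' (Eventually.of_forall fun p => dist_nonneg) ?_ hbound
    filter_upwards [(hA.and hgk).prod_mk (hA.and hgk)] with p hp
    obtain ⟨⟨hA1, hg1⟩, ⟨hA2, hg2⟩⟩ := hp
    exact Summit.QuantumFields.YangMills.Cruxes.ContinuumLimitOnTrajectory.TwoOrbitSynchronisation.Reduction.pair_bound
      𝒞 hγ'pos hγ'le hK hθ₁0 hc_r hsmall hSk hpin hg1.1 hg2.1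
      hA1.2.1 hA2.2.1 hA1.2.2.1 hA2.2.2.1 hA1.2.2.2.1 hA2.2.2.2.1 hA1.2.2.2.2 hA2.2.2.2.2
  /- the limit point, inside the closed window region -/
  obtain ⟨qs, hqs⟩ := cauchySeq_tendsto_of_complete hcauchy
  have hqW : ∀ᶠ k in atTop, q k ∈ 𝒞.W := by
    filter_upwards [hA] with k hk
    refine Set.mem_prod.2 ⟨⟨(hk.2.2.1 (J k) le_rfl).1, (hk.2.2.1 (J k) le_rfl).2.trans hγ'le⟩, ?_⟩
    rw [Metric.mem_closedBall, dist_zero_right]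
    exact hk.2.2.2.1 (J k) hk.2.1 le_rfl
  have hqsW : qs ∈ 𝒞.W := 𝒞.isClosed_W.mem_of_tendsto hqs hqW
  /- full-sequence convergence on products -/
  have hconv : ConvProducts r sch := by
    intro p hp f hf
    refine ⟨𝒞.expectInf qs p fun i => (blockDilate M)^[m] (f i), ?_⟩
    have hcont := (𝒞.continuousOn_expect p m f hf).continuousWithinAt hqsW
    have hv : Tendsto (fun k => 𝒞.expectInf (q k) p fun i => (blockDilate M)^[m] (f i)) atTop
        (𝓝 (𝒞.expectInf qs p fun i => (blockDilate M)^[m] (f i))) :=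
      hcont.tendsto.comp (tendsto_nhdsWithin_iff.2 ⟨hqs, hqW⟩)
    refine tendsto_of_forall_eventually_abs_sub_le hv fun ε hε => ?_
    filter_upwards [hvol'.1 p f hf ε hε, hA, hgk] with k hk hAk hg'
    have e1 : (𝒞.expectInf (q k) p fun i => (blockDilate M)^[m] (f i)) =
        𝒞.expectInf (𝒞.orb (g k) 0) p fun i => (blockDilate M)^[n k] (f i) := by
      show 𝒞.expectInf (𝒞.orb (g k) (J k)) p _ = _
      rw [𝒞.expect_iterate hg'.1 (J k) p]
      congr 1
      funext i
      rw [← Function.iterate_add_apply, hAk.1]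
    have hlim := 𝒞.expect_wilson (g k) hg'.1 p fun i => (blockDilate M)^[n k] (f i)
    rw [hg'.2] at hlim
    rw [e1]
    exact abs_sub_le_of_uniform hlim hk
  /- UV inputs, the three lattice-kinematics stubs, and the OS legs -/
  obtain ⟨hUUVB, h345, hND2, hND3⟩ :=
    huv G hG r M θ Δ sch n hθ hΔ hshape hβ htower htune hgap hgrowth hconv
  -- rotation restoration from ONE Pythagorean rotation (sibling crux stmt-15828, landed p133709 + p133202 + p133520)
  have hRot : AsympRot r sch := stub_rotOfPythagorean G r sch stub_rotNiven stub_rotHyper hUUVB h345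
  have hUVB : UVB r sch := uvb_of_uuvb r sch hUUVB
  have hARP : ARP r sch := harp G r sch (torusSlabRP_of_tendsto r sch hβ) hUUVB hUVB
  have hE1 : AsympEuclid r sch := (asympEuclid_iff r sch).2 ⟨htransl G r sch hgrowth hUUVB, hRot⟩
  -- E4 from Cauchy–Schwarz clustering of the canonical scheme (sibling crux stmt-15828, landed p132690 + wave-6 glue)
  have hUCL : UCL r sch :=
    stub_uclOfCscl G r sch stub_asympCS stub_smallRotation stub_bddSlabDensity hβ hUUVB hgrowth hRot ⟨Δ₁, hΔ₁, hCS⟩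
  obtain ⟨T, hYM, hNT, hNG⟩ := hlegs G r sch hconv hUVB hE1 hARP hUCL hND2 hND3
  -- the ONLY change w.r.t. `reductionUV`: keep the continuum gap of the canonical witness
  exact ⟨canon r sch, rfl, rfl, rfl, T, hYM, hNT, hNG, Δ₁, hΔ₁, hYM.hasMassGap_of_hasCSClustering hCS⟩

end Reduction

/-- **Child U in gap currency from exactly the TWO named statements that close child U** — the PROMOTED two-orbit
chart `ChartExists` and the volume-uniform UV engine `UVPhysics345` — applied to the landed stubs `stub_sync`,
`stub_anatomy`, `stub_arp`, `stub_transl`, `stub_osPackaging` (cf. `RegimeTrisection.ultravioletLimitOnTrajectory_of_inputs`).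
So re-typing child U in gap currency costs the (A) chain NOTHING. -/
theorem ultravioletLimitWithGapOnTrajectory_of_inputs :
    ChartExists → UVPhysics345 → UltravioletLimitWithGapOnTrajectory :=
  fun hchart huv => Reduction.reductionUVGap stub_sync hchart stub_anatomy huv stub_arp stub_transl stub_osPackaging

/-! ## §4 The coherent rev-8 deciding theorems: (B) enters only as a pure-lattice statement -/

/-- **`U_gap → I → (B_Lat) → (S_PVG) → YangMills` — the regime trisection re-glued in gap currency.** Fix `G`;
`IsCompactSimpleLieGroup G` gives `r`; take `M = max M₀ 2` and `θ₀` from child U in gap currency, `θ₁` from (S_PVG),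
`θ = min θ₀ θ₁ / 2`; (S_PVG) gives a tuned `M`-adic weak-coupling scheme `sch` WITH polynomial volume growth; (B_Lat)
(`Split.LatticeGapOnTrajectoryLat`, Sub₁ of the (B) chain — pure lattice, no transfer clause, no volume clause) gives
`Δ > 0` and `HasLatticeMassGap r sch Δ` (its slab-clustering conjunct is not needed here); child I supplies the infrared
data of the sequence; child U in gap currency gives the witness `sch'` (same `a, β, L`), `T`, and `Δ₁ > 0` with
`T.HasMassGap Δ₁`; the sub-problem's gap is `min Δ Δ₁` (both clauses antitone: `osData_hasMassGap_anti'`,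
`Split.hasLatticeMassGap_of_le`), the lattice clause rewritten along `sch'.(a,β,L) = sch.(a,β,L)` and the weak-coupling
conjunct transported along `sch'.β = sch.β`. NO use of (B)'s filed transfer clause `∀ sch'`, none of reflection symmetry,
none of `sch.HasVolumeGrowth`: neither residual (α) nor residual (β) of the (B) chain is on the path. -/
theorem yangMills_of_trisectionGap :
    UltravioletLimitWithGapOnTrajectory → ClusteringOnTrajectory → Split.LatticeGapOnTrajectoryLat →
      TunedSequenceExistsPVG → YangMills := by
  intro hU hI hB hS G _ _ _ _ hG
  obtain ⟨r⟩ := hG.2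
  letI : MeasurableSpace G := borel G
  haveI : BorelSpace G := ⟨rfl⟩
  obtain ⟨M₀, hM₀⟩ := hU G hG r
  have hM2 : 2 ≤ max M₀ 2 := le_max_right _ _
  obtain ⟨θ₀, hθ₀, hU'⟩ := hM₀ (max M₀ 2) (le_max_left _ _) hM2
  obtain ⟨θ₁, hθ₁, hS'⟩ := hS G hG r (max M₀ 2) hM2
  have hθpos : 0 < min θ₀ θ₁ / 2 := by positivity
  have hθlt₀ : min θ₀ θ₁ / 2 < θ₀ := by have := min_le_left θ₀ θ₁; linarith
  have hθlt₁ : min θ₀ θ₁ / 2 < θ₁ := by have := min_le_right θ₀ θ₁; linarith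
  obtain ⟨sch, n, hshape, hbeta, hconv, htune, hgrowth⟩ := hS' (min θ₀ θ₁ / 2) hθpos hθlt₁
  obtain ⟨Δ, hΔ, hgap, -⟩ := hB G hG r (max M₀ 2) (min θ₀ θ₁ / 2) sch n hM2 hθpos hshape hbeta htune
  have hIR := hI G hG r (max M₀ 2) (min θ₀ θ₁ / 2) Δ sch n hθpos hΔ hshape hbeta hconv htune hgap hgrowth
  obtain ⟨sch', ha, hβ, hL, T, hYM, hNT, hNG, Δ₁, hΔ₁, hTgap⟩ :=
    hU' (min θ₀ θ₁ / 2) Δ sch n hθpos hθlt₀ hΔ hshape hbeta hconv htune hgap hgrowth hIR.1 hIR.2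
  have hweak : sch'.HasWeakCouplingLimit := by
    show Tendsto sch'.β atTop atTop
    rw [hβ]
    exact hbeta
  have hgap' : HasLatticeMassGap r sch (min Δ Δ₁) := Split.hasLatticeMassGap_of_le r sch (min_le_left _ _) hgap
  refine ⟨r, sch', T, hweak, hYM, hNT, hNG, min Δ Δ₁, lt_min hΔ hΔ₁,
    osData_hasMassGap_anti' T (min_le_right _ _) hTgap, ?_⟩
  intro A B
  obtain ⟨C, hC⟩ := hgap' A B
  refine ⟨C, ?_⟩
  simpa only [ha, hβ, hL] using hC

/-- **The same with the (B) chain's 1:1 restatement `Split.LatticeGapOnTrajectoryRV`** ((B) + `HasVolumeGrowth`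
hypothesis, transfer clause restricted to reflection-symmetric witnesses): only its LATTICE clause is used, and its volume
hypothesis is supplied from the polynomial volume growth output by (S_PVG)
(`TwoOrbitSynchronisation.hasVolumeGrowth_of_polyVolumeGrowth`, p145719). -/
theorem yangMills_of_trisectionGapRV :
    UltravioletLimitWithGapOnTrajectory → ClusteringOnTrajectory → Split.LatticeGapOnTrajectoryRV →
      TunedSequenceExistsPVG → YangMills := by
  intro hU hI hB hS G _ _ _ _ hG
  obtain ⟨r⟩ := hG.2
  letI : MeasurableSpace G := borel G
  haveI : BorelSpace G := ⟨rfl⟩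
  obtain ⟨M₀, hM₀⟩ := hU G hG r
  have hM2 : 2 ≤ max M₀ 2 := le_max_right _ _
  obtain ⟨θ₀, hθ₀, hU'⟩ := hM₀ (max M₀ 2) (le_max_left _ _) hM2
  obtain ⟨θ₁, hθ₁, hS'⟩ := hS G hG r (max M₀ 2) hM2
  have hθpos : 0 < min θ₀ θ₁ / 2 := by positivity
  have hθlt₀ : min θ₀ θ₁ / 2 < θ₀ := by have := min_le_left θ₀ θ₁; linarith
  have hθlt₁ : min θ₀ θ₁ / 2 < θ₁ := by have := min_le_right θ₀ θ₁; linarith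
  obtain ⟨sch, n, hshape, hbeta, hconv, htune, hgrowth⟩ := hS' (min θ₀ θ₁ / 2) hθpos hθlt₁
  have hvol : sch.HasVolumeGrowth := hasVolumeGrowth_of_polyVolumeGrowth sch hgrowth
  obtain ⟨Δ, hΔ, hgap, -⟩ := hB G hG r (max M₀ 2) (min θ₀ θ₁ / 2) sch n hM2 hθpos hshape hbeta hvol htune
  have hIR := hI G hG r (max M₀ 2) (min θ₀ θ₁ / 2) Δ sch n hθpos hΔ hshape hbeta hconv htune hgap hgrowth
  obtain ⟨sch', ha, hβ, hL, T, hYM, hNT, hNG, Δ₁, hΔ₁, hTgap⟩ :=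
    hU' (min θ₀ θ₁ / 2) Δ sch n hθpos hθlt₀ hΔ hshape hbeta hconv htune hgap hgrowth hIR.1 hIR.2
  have hweak : sch'.HasWeakCouplingLimit := by
    show Tendsto sch'.β atTop atTop
    rw [hβ]
    exact hbeta
  have hgap' : HasLatticeMassGap r sch (min Δ Δ₁) := Split.hasLatticeMassGap_of_le r sch (min_le_left _ _) hgap
  refine ⟨r, sch', T, hweak, hYM, hNT, hNG, min Δ Δ₁, lt_min hΔ hΔ₁,
    osData_hasMassGap_anti' T (min_le_right _ _) hTgap, ?_⟩
  intro A B
  obtain ⟨C, hC⟩ := hgap' A B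
  refine ⟨C, ?_⟩
  simpa only [ha, hβ, hL] using hC

/-- **The whole route modulo five named statements, in trisection clothing**: Bałaban's two-orbit chart `ChartExists`
and the volume-uniform UV engine `UVPhysics345` (the two inputs of child U — in either currency), the infrared child I
`ClusteringOnTrajectory`, the (B) chain's pure-lattice Sub₁ `Split.LatticeGapOnTrajectoryLat` (closed by three (B) lines
modulo one physics stub each: `Split.latticeGapOnTrajectoryLat_of_windowsP`, `…DecayInterface`, `…StepScaling`), and the
repaired (S) `TunedSequenceExistsPVG`. The filed (B) `LatticeGapOnTrajectory`, its residuals (α)/(β), the artefact child V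
and the parent (A) are all off the path. -/
theorem yangMills_of_trisectionGap_inputs :
    ChartExists → UVPhysics345 → ClusteringOnTrajectory → Split.LatticeGapOnTrajectoryLat →
      TunedSequenceExistsPVG → YangMills :=
  fun hchart huv => yangMills_of_trisectionGap (ultravioletLimitWithGapOnTrajectory_of_inputs hchart huv)

/-- **Consistency with the pre-trisection reconciliation** (`TwoOrbitSynchronisation.yangMills_of_gapCurrency`, p145719):
the (A) chain's global gap-currency restatement `ContinuumLimitWithGapPVG` also runs the trisection glue, through
`ultravioletLimitWithGapOnTrajectory_of_withGapPVG`. -/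
theorem yangMills_of_withGapPVG_trisection :
    ContinuumLimitWithGapPVG → ClusteringOnTrajectory → Split.LatticeGapOnTrajectoryLat →
      TunedSequenceExistsPVG → YangMills :=
  fun hA => yangMills_of_trisectionGap (ultravioletLimitWithGapOnTrajectory_of_withGapPVG hA)

end Summit.QuantumFields.YangMills.Cruxes.LatticeGapOnTrajectory.TrisectionGap

end
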